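import Literature.Claims.NS.Dou2026b
import Literature.Analysis.FluidPDE.NSQuasipotential
import HarnessLib

/-!
# C54b `Dou2026b` — erratum-column kernel fact: `Step3_meanFlowDominance` is FALSE as typed (not vacuous)

Text of record: Hua-Shu Dou, «Non-Existence of Global Smooth Solutions to the 3D Navier–Stokes
Equations in a Periodic Domain with Prescribed Body Force», Preprints.org 202606.0089 v1 (2026),
printed page N = PDF page N+1. Skeleton `Literature.Claims.NS.Dou2026b` (typist-3 g2, p481603);
verdict #67 (locator `Step2_dataInClass`, class vacuous) is NOT touched by this file.

The skeleton's docstring for Step 3 (§4.3 (19) print p.6 with (39) print p.11: «inf_Ω U ≥ C₀ > 0 …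
‖v‖_{L∞} ≪ ‖U‖_{L∞}») says «vacuous over the typed class by Step 2». That is inaccurate: the typed
`Step3_meanFlowDominance` quantifies over ALL profile parameters `(a, b)` — it does not carry the
printed property 3 (positivity of the profile) under which Step 2 empties the class — and at
`a = b = 0`, `p_Lx = 0` the printed force (10) is `F/ρ = (12νb y²/h⁴, 0, 0) = 0` and the datum (13) is
`0`, so the REST STATE `u ≡ 0`, `p ≡ 0` is a rendered solution on `[0, ∞)`. Its mean flow (15) is
`U ≡ 0`, so «∃ C₀ > 0, C₀ ≤ |U(x,t)|» fails: `¬ Step3_meanFlowDominance`.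

* `rest_isRenderedSolutionOn` — the rest state lies in the rendered class at `a = b = p_Lx = 0`.
* `not_Step3_meanFlowDominance : ¬ Step3_meanFlowDominance`.

Records-grade (erratum column of #67); ns-claims-typist-3 g5 (C54b typing lineage), 2026-08-27.

WHAT THIS IS NOT: not a claim about NS regularity or blow-up; not a claim about any author beyond the
typed locator.
-/

noncomputable section

open Set MeasureTheory intervalIntegral

namespace Summit.NavierStokesRegularity.NavierStokesRegularity.Theorems.Dou2026bStep3

open Literature.Analysis.FluidPDE Literature.Claims.NS.Dou2026b

/-- At `b = 0` the printed body force (10) vanishes identically. [cite: Dou2026b, eq. (10) print p.4] -/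
theorem force_zero (ν h : ℝ) : force ν 0 h = 0 := by
  funext t x
  simp [force]

/-- At `a = b = 0` the printed datum (13) vanishes identically. [cite: Dou2026b, eq. (13) print p.5] -/
theorem datum_zero (h : ℝ) (x : EuclideanSpace ℝ (Fin 3)) : datum 0 0 h x = 0 := by
  simp [datum, profile]

/-- **The rest state is a rendered solution at `a = b = p_Lx = 0`** (every `ν`, `h`, `Lx`): it solves
the system with the (vanishing) force (10) classically on `[0,∞)` (`isClassicalNSSolutionOn_zero`),
is box-periodic with zero pressure drop, has bounded (zero) gradient, and attains the (vanishing)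
datum (13). [cite: Dou2026b, eqs. (1)–(3), (9), (10), (13) print p.3–5] -/
theorem rest_isRenderedSolutionOn (ν h Lx : ℝ) :
    IsRenderedSolutionOn (Ici 0) ν 0 0 h Lx 0 (0 : ℝ → EuclideanSpace ℝ (Fin 3) → EuclideanSpace ℝ (Fin 3))
      0 where
  ns := by
    rw [force_zero]
    exact isClassicalNSSolutionOn_zero (Ici 0) ν
  periodic_velocity := fun _ _ _ => ⟨rfl, rfl, rfl⟩
  periodic_pressure := fun _ _ _ => by simp
  gradient_bounded := fun _ _ => ⟨0, fun x => by simp⟩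
  initial := fun x _ => by simp [datum_zero]

/-- **Step 3 (§4.3 (19) / (39)) is false as typed**: for the rest state (a rendered solution at
`a = b = p_Lx = 0`, `ν = h = Lx = 1`) the mean flow (15) over any window is `0`, so no `C₀ > 0` bounds
it from below. [cite: Dou2026b, eq. (19) print p.6; eq. (39) print p.11; eq. (15) print p.6] -/
theorem not_Step3_meanFlowDominance : ¬ Step3_meanFlowDominance := by
  intro h3
  obtain ⟨C₀, hC₀, hall⟩ :=
    h3 1 1 1 0 0 0 0 0 one_pos one_pos one_pos (rest_isRenderedSolutionOn 1 1 1) 1 one_pos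
  have hle := (hall 0 le_rfl 0).1
  have hU : meanFlow 1 (0 : ℝ → EuclideanSpace ℝ (Fin 3) → EuclideanSpace ℝ (Fin 3)) 0 0 = 0 := by
    simp [meanFlow]
  rw [hU, norm_zero] at hle
  exact absurd hle (not_le.2 hC₀)

end Summit.NavierStokesRegularity.NavierStokesRegularity.Theorems.Dou2026bStep3

end

-- WHAT THIS IS NOT: not a claim about NS regularity or blow-up; not a claim about any author beyond the
-- typed locator.
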